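import Summits.CriticalPhenomena.CardyFormulaZ2.Theorems.CardyUniqueLimitCardyRigidityFarFieldFlow
import Summits.CriticalPhenomena.CardyFormulaZ2.Theorems.CardyUniqueLimitCardyRigidityFarFieldEtaExpansion
import Summits.CriticalPhenomena.CardyFormulaZ2.Theorems.CardyUniqueLimitCardyRigidityFarFieldScale

/-!
# The far-field expansion of the stopped modulus, pathwise at scale `n` (line `crossing-martingale`, crux `CardyRigidity`)

Pathwise layer of the far-field MOMENT engine (stubs `stub_betaPinning` / `stub_kernelAffineBeta`,
crux `CardyRigidity`, stmt-CriticalPhenomena-0746).  Marks `xₙ = n x̂` (`x̂ = (a, b, c)`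
admissible), TIGHT levels `mₙ = na - n^{3/4}`, `Mₙ = na + n^{3/4}`, `dₙ = n·min(b-a, c-b) - n^{3/4}`
(`…FarFieldScale`), a continuous path `W ω` with `W ω 0 = 0`, a time `t`, and the increment
`hₙ = η(X_{t∧ρₙ}) - η(x̂)` of the stopped modulus:

* `abs_incr_le_sure` — the SURE bound `|hₙ| ≤ 3L (n^{3/4}+1)/n` for every path (tight levels +
  Lipschitz bound of the modulus; registered anchor `farField_abs_incr_le_sure`);
* `abs_incr_sub_main_le_of_good` — on the good event `sup_{u≤t}|W_u| ≤ K ≤ n^{3/4}/2` no level is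
  reached before `t` and
  `|η(X_t) - η(x̂'ₙ) + S₁'ₙ W_t/n + (S₁'ₙ/b'ₙ) W_t²/n²| ≤ 2(S₁'ₙ/b'ₙ²)(K/n)³ + 36 L t (K+1)/(a² n³)`,
  with the drifted base `x̂'ₙ = (x̂ᵢ + 2t/(n² x̂ᵢ))ᵢ`, its translation coefficient `S₁'ₙ` and
  middle coordinate `b'ₙ` (`…FarFieldEtaExpansion`).

No probability here.
-/

noncomputable section

open MeasureTheory Filter Set Topology
open scoped NNReal ENNReal
open Literature.Probability.RandomPlanarGeometry
open Literature.Probability.Process (exitTime coe_untopA_min_le)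

namespace Summit.CriticalPhenomena.CardyFormulaZ2.Cruxes.CardyRigidity.CrossingMartingale

namespace FarField

variable {a b c : ℝ}

/-! ### The stopped modulus at scale `n`: the sure bound -/

section Scale

variable {Ω : Type*} {W : Ω → ℝ≥0 → ℝ} {ω : Ω}

/-- Values of the scaled mark vector. [folklore] -/
theorem scaleMarks_apply (n : ℝ) (a b c : ℝ) :
    (fun i ↦ n * ![a, b, c] i) 0 = n * a ∧ (fun i ↦ n * ![a, b, c] i) 1 = n * b ∧
      (fun i ↦ n * ![a, b, c] i) 2 = n * c := by
  simp

/-- **The sure bound on the stopped-modulus increment.**  For EVERY continuous path with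
`W ω 0 = 0`, at large scale `n` (the inequalities of `eventually_scale`), the modulus at the stopped
clock `t ∧ levelTime` of the tight data differs from `η(a,b,c)` by at most `3L (n^{3/4}+1)/n`
(`L` the Lipschitz constant of `abs_cardyEta_sub_le_of_box`). [folklore] -/
theorem abs_incr_le_sure (ha : 0 < a) (hab : a < b) (hbc : b < c) (t : ℝ≥0) {n : ℕ}
    (hn : 0 < n) (hq : ((n : ℝ)) ^ (3 / 4 : ℝ) < n * min a (min (b - a) (c - b)))
    (hqa : ((n : ℝ)) ^ (3 / 4 : ℝ) ≤ n * a / 2)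
    (h4t : 4 * (t : ℝ) / (n * a) < min 1 (((n : ℝ)) ^ (3 / 4 : ℝ) / 2))
    (hρ : (((n : ℝ)) ^ (3 / 4 : ℝ) + 1) / n ≤ min (min a (b - a)) (c - b) / 4)
    (hWc : Continuous (W ω)) (hW0 : W ω 0 = 0) :
    |etaProc W (fun i ↦ (n : ℝ) * ![a, b, c] i)
        (min (t : WithTop ℝ≥0) (levelTime W (fun i ↦ (n : ℝ) * ![a, b, c] i)
          (n * a - (n : ℝ) ^ (3 / 4 : ℝ)) (n * a + (n : ℝ) ^ (3 / 4 : ℝ))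
          (n * min (b - a) (c - b) - (n : ℝ) ^ (3 / 4 : ℝ)) ω)).untopA ω - cardyEta a b c| ≤
      (10 * c * (c - b) / (b * (c - a) ^ 2) + 6 * a * c / (b ^ 2 * (c - a)) +
        10 * a * (b - a) / (b * (c - a) ^ 2)) * (3 * ((((n : ℝ)) ^ (3 / 4 : ℝ) + 1) / n)) := by
  set q : ℝ := ((n : ℝ)) ^ (3 / 4 : ℝ) with hqdef
  set x : Fin 3 → ℝ := fun i ↦ (n : ℝ) * ![a, b, c] i with hxdef
  set m : ℝ := n * a - q with hmdef
  set M : ℝ := n * a + q with hMdef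
  set d : ℝ := n * min (b - a) (c - b) - q with hddef
  have hnpos : (0 : ℝ) < n := by exact_mod_cast hn
  have hqpos : 0 < q := Real.rpow_pos_of_pos hnpos _
  have hadm : AdmissibleLevels x m M d := admissibleLevels_scale ha hab hbc hn hq
  obtain ⟨hx0, hx1, hx2⟩ := scaleMarks_apply (n : ℝ) a b c
  set u : ℝ≥0 := (min (t : WithTop ℝ≥0) (levelTime W x m M d ω)).untopA with hudef
  have hule : (u : WithTop ℝ≥0) ≤ levelTime W x m M d ω := coe_untopA_min_le t _
  have hut : u ≤ t := Literature.Probability.Process.untopA_min_coe_le t _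
  -- every mark within `q + 1` of its start
  have hmpos : 0 < m := hadm.m_pos
  have hm_ge : n * a / 2 ≤ m := by simp only [hmdef]; linarith
  have h2um : 2 * (u : ℝ) / m ≤ 1 := by
    have h1 : 2 * (u : ℝ) / m ≤ 2 * t / m := by
      have : (u : ℝ) ≤ t := by exact_mod_cast hut
      gcongr
    have h2 : 2 * (t : ℝ) / m ≤ 4 * t / (n * a) := by
      rw [div_le_div_iff₀ hmpos (by positivity)]
      nlinarith [t.coe_nonneg]
    have h3 : 4 * (t : ℝ) / (n * a) < 1 := h4t.trans_le (min_le_left _ _)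
    linarith
  have hclose : ∀ i, |markFlow W (x i) u ω - x i| ≤ q + 1 := by
    intro i
    have h := abs_markFlow_sub_le_of_le_levelTime hWc hW0 hadm hule i
    have hmax : max (x 0 - m) (M - x 0) = q := by
      have hx0' : x 0 = n * a := by simp [hxdef]
      rw [hx0']
      simp only [hmdef, hMdef]
      rw [show (n : ℝ) * a - (n * a - q) = q by ring, show (n : ℝ) * a + q - n * a = q by ring,
        max_self]
    rw [hmax] at h
    linarith
  -- rescale
  have hresc : ∀ i, |markFlow W (x i) u ω / n - ![a, b, c] i| ≤ (q + 1) / n := by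
    intro i
    have : markFlow W (x i) u ω / n - ![a, b, c] i = (markFlow W (x i) u ω - x i) / n := by
      simp only [hxdef]; field_simp
    rw [this, abs_div, abs_of_pos hnpos]
    exact div_le_div_of_nonneg_right (hclose i) hnpos.le
  have hη : etaProc W x u ω = cardyEta (markFlow W (x 0) u ω / n) (markFlow W (x 1) u ω / n)
      (markFlow W (x 2) u ω / n) := by
    rw [← cardyEta_mul hnpos.ne' (markFlow W (x 0) u ω / n)]
    simp only [etaProc, mul_div_cancel₀ _ hnpos.ne']
  rw [hη]
  have h0 := hresc 0
  have h1 := hresc 1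
  have h2 := hresc 2
  simp only [Matrix.cons_val_zero, Matrix.cons_val_one, Matrix.cons_val] at h0 h1 h2
  have hρ0 : 0 ≤ (q + 1) / n := by positivity
  have hL := abs_cardyEta_sub_le_of_box ha hab hbc hρ (p₀ := a) (p₁ := b) (p₂ := c)
    (by simpa using hρ0) (by simpa using hρ0) (by simpa using hρ0) h0 h1 h2
  refine hL.trans ?_
  have hb : 0 < b := ha.trans hab
  have hca : 0 < c - a := by linarith
  have hLnn : 0 ≤ 10 * c * (c - b) / (b * (c - a) ^ 2) + 6 * a * c / (b ^ 2 * (c - a)) +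
      10 * a * (b - a) / (b * (c - a) ^ 2) := by
    have hc : 0 < c := hb.trans hbc
    have hden1 : 0 < b * (c - a) ^ 2 := mul_pos hb (pow_pos hca 2)
    have hden2 : 0 < b ^ 2 * (c - a) := mul_pos (pow_pos hb 2) hca
    have h1 : 0 ≤ 10 * c * (c - b) / (b * (c - a) ^ 2) :=
      div_nonneg (mul_nonneg (by positivity) (by linarith)) hden1.le
    have h2 : 0 ≤ 6 * a * c / (b ^ 2 * (c - a)) := div_nonneg (by positivity) hden2.le
    have h3 : 0 ≤ 10 * a * (b - a) / (b * (c - a) ^ 2) :=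
      div_nonneg (mul_nonneg (by positivity) (by linarith)) hden1.le
    linarith
  exact mul_le_mul_of_nonneg_left (by linarith) hLnn

set_option maxHeartbeats 800000 in
-- one long pathwise estimate; the context (three `set` levels, rescaled marks) is large
/-- **The far-field expansion on the good event.**  For a continuous path with `W ω 0 = 0` whose
running supremum on `[0, t]` is at most `K ≤ n^{3/4}/2`, at large scale `n` (inequalities of
`eventually_scale`): no level of the tight data is reached before `t`, and with `r = 2t/n²`, the
drifted base `a' = a + r/a`, `b' = b + r/b`, `c' = c + r/c`, `S₁' = (b'-a')(c'-b')/(b'²(c'-a'))`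
and the shift `s = W_t/n`,
`|η(X_t) - η(a',b',c') + S₁' s + (S₁'/b') s²| ≤ 2(S₁'/b'²)(K/n)³ + 3 L · 4t(K+1)/(a²n³)`.
[folklore] -/
theorem abs_incr_sub_main_le_of_good (ha : 0 < a) (hab : a < b) (hbc : b < c) (t : ℝ≥0) {n : ℕ}
    (hn : 0 < n) (hq : ((n : ℝ)) ^ (3 / 4 : ℝ) < n * min a (min (b - a) (c - b)))
    (hqa : ((n : ℝ)) ^ (3 / 4 : ℝ) ≤ n * a / 2)
    (h4t : 4 * (t : ℝ) / (n * a) < min 1 (((n : ℝ)) ^ (3 / 4 : ℝ) / 2))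
    (hρ' : 2 * (t : ℝ) / ((n : ℝ) ^ 2 * a) + ((n : ℝ)) ^ (3 / 4 : ℝ) / (2 * n) +
        4 * t * (((n : ℝ)) ^ (3 / 4 : ℝ) / 2 + 1) / (a ^ 2 * (n : ℝ) ^ 3) ≤
          min (min a (b - a)) (c - b) / 4)
    (hWc : Continuous (W ω)) (hW0 : W ω 0 = 0) {K : ℝ} (hK0 : 0 ≤ K)
    (hK : ∀ s : ℝ≥0, s ≤ t → |W ω s| ≤ K) (hKq : K ≤ ((n : ℝ)) ^ (3 / 4 : ℝ) / 2)
    {r : ℝ} (hr : r = 2 * (t : ℝ) / (n : ℝ) ^ 2) :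
    (t : WithTop ℝ≥0) < levelTime W (fun i ↦ (n : ℝ) * ![a, b, c] i)
        (n * a - (n : ℝ) ^ (3 / 4 : ℝ)) (n * a + (n : ℝ) ^ (3 / 4 : ℝ))
        (n * min (b - a) (c - b) - (n : ℝ) ^ (3 / 4 : ℝ)) ω ∧
      |etaProc W (fun i ↦ (n : ℝ) * ![a, b, c] i) t ω - cardyEta (a + r / a) (b + r / b) (c + r / c)
          + (b + r / b - (a + r / a)) * (c + r / c - (b + r / b)) /
              ((b + r / b) ^ 2 * (c + r / c - (a + r / a))) * (W ω t / n)
          + (b + r / b - (a + r / a)) * (c + r / c - (b + r / b)) /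
              ((b + r / b) ^ 2 * (c + r / c - (a + r / a))) / (b + r / b) * (W ω t / n) ^ 2| ≤
        2 * ((b + r / b - (a + r / a)) * (c + r / c - (b + r / b)) /
              ((b + r / b) ^ 2 * (c + r / c - (a + r / a)))) / (b + r / b) ^ 2 * (K / n) ^ 3 +
          (10 * c * (c - b) / (b * (c - a) ^ 2) + 6 * a * c / (b ^ 2 * (c - a)) +
            10 * a * (b - a) / (b * (c - a) ^ 2)) * (3 * (4 * t * (K + 1) / (a ^ 2 * (n : ℝ) ^ 3))) := by
  set q : ℝ := ((n : ℝ)) ^ (3 / 4 : ℝ) with hqdef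
  set x : Fin 3 → ℝ := fun i ↦ (n : ℝ) * ![a, b, c] i with hxdef
  set m : ℝ := n * a - q with hmdef
  set M : ℝ := n * a + q with hMdef
  set d : ℝ := n * min (b - a) (c - b) - q with hddef
  have hnpos : (0 : ℝ) < n := by exact_mod_cast hn
  have hqpos : 0 < q := Real.rpow_pos_of_pos hnpos _
  have hb : 0 < b := ha.trans hab
  have hc : 0 < c := hb.trans hbc
  have hadm : AdmissibleLevels x m M d := admissibleLevels_scale ha hab hbc hn hq
  have hxv : ∀ i, x i = n * ![a, b, c] i := fun i ↦ rfl
  have hx0 : x 0 = n * a := by simp [hxdef]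
  have hx1 : x 1 = n * b := by simp [hxdef]
  have hx2 : x 2 = n * c := by simp [hxdef]
  have hmpos : 0 < m := hadm.m_pos
  have hm_ge : n * a / 2 ≤ m := by simp only [hmdef]; linarith
  have ht0 : (0 : ℝ) ≤ t := t.coe_nonneg
  -- `2t/m ≤ 4t/(na) < min 1 (q/2)`
  have h2tm : 2 * (t : ℝ) / m ≤ 4 * t / (n * a) := by
    rw [div_le_div_iff₀ hmpos (by positivity)]
    nlinarith
  have h2tm1 : 2 * (t : ℝ) / m < 1 := (h2tm.trans_lt (h4t.trans_le (min_le_left _ _)))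
  have h2tmq : 2 * (t : ℝ) / m < q / 2 := (h2tm.trans_lt (h4t.trans_le (min_le_right _ _)))
  have h2tm0 : 0 ≤ 2 * (t : ℝ) / m := by positivity
  -- STEP 1: no level before `t`
  have hlt : (t : WithTop ℝ≥0) < levelTime W x m M d ω := by
    refine coe_lt_levelTime_of_forall_abs_le hWc hW0 hadm hK ?_ ?_ ?_ ?_ h2tm1
    · rw [hx0]; simp only [hmdef]; linarith
    · rw [hx0]; simp only [hMdef]; linarith
    · rw [hx0, hx1]; simp only [hddef]
      have : (n : ℝ) * min (b - a) (c - b) ≤ n * (b - a) := by gcongr; exact min_le_left _ _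
      linarith
    · rw [hx1, hx2]; simp only [hddef]
      have : (n : ℝ) * min (b - a) (c - b) ≤ n * (c - b) := by gcongr; exact min_le_right _ _
      linarith
  refine ⟨hlt, ?_⟩
  -- STEP 2: flow representation at time `t` and the drift bounds
  obtain ⟨-, -, hrep, hI0, hIle, -⟩ := flows_of_le_levelTime hWc hW0 hadm hlt.le
  have hKx : ∀ i, K < x i := by
    intro i
    have hxi : n * a ≤ x i := by
      rw [hxv i]
      have : a ≤ ![a, b, c] i := by fin_cases i <;> simp <;> linarith
      exact mul_le_mul_of_nonneg_left this hnpos.le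
    linarith
  have hdrift := fun i ↦ abs_driftIntegral_sub_le hWc hW0 hadm hK hlt.le i (hKx i)
  -- the rescaled perturbation data
  set s : ℝ := W ω t / n with hsdef
  set I : Fin 3 → ℝ := fun i ↦ ∫ u in (0 : ℝ)..(t : ℝ), (2 : ℝ) / markFlow W (x i) u.toNNReal ω
    with hIdef
  set ε : Fin 3 → ℝ := fun i ↦ (I i - 2 * t / x i) / n with hεdef
  have hWt : |W ω t| ≤ K := hK t le_rfl
  have hs_le : |s| ≤ K / n := by
    rw [hsdef, abs_div, abs_of_pos hnpos]; exact div_le_div_of_nonneg_right hWt hnpos.le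
  -- `|εᵢ| ≤ 4t(K+1)/(a² n³)` and `≤ 4t(q/2+1)/(a² n³)`
  have hε_bound : ∀ i, |ε i| ≤ 4 * t * (K + 1) / (a ^ 2 * (n : ℝ) ^ 3) ∧
      |ε i| ≤ 4 * t * (q / 2 + 1) / (a ^ 2 * (n : ℝ) ^ 3) := by
    intro i
    have hxi : n * a ≤ x i := by
      rw [hxv i]
      have : a ≤ ![a, b, c] i := by fin_cases i <;> simp <;> linarith
      exact mul_le_mul_of_nonneg_left this hnpos.le
    have hxK : n * a / 2 ≤ x i - K := by linarith
    have hxipos : 0 < x i := by nlinarith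
    have h1 : |ε i| = |I i - 2 * t / x i| / n := by
      simp only [hεdef]; rw [abs_div, abs_of_pos hnpos]
    have h2 : |I i - 2 * t / x i| ≤ 2 * t * ((K + 2 * t / m) / ((x i - K) * x i)) := hdrift i
    have hden : n * a / 2 * (n * a) ≤ (x i - K) * x i :=
      mul_le_mul hxK hxi (by positivity) (by linarith)
    have hden0 : 0 < n * a / 2 * (n * a) := by positivity
    have key : ∀ {L : ℝ}, K + 2 * t / m ≤ L → 0 ≤ L →
        |ε i| ≤ 4 * t * L / (a ^ 2 * (n : ℝ) ^ 3) := by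
      intro L hL hL0
      rw [h1, div_le_iff₀ hnpos]
      calc |I i - 2 * t / x i| ≤ 2 * t * ((K + 2 * t / m) / ((x i - K) * x i)) := h2
        _ ≤ 2 * t * (L / (n * a / 2 * (n * a))) := by
            apply mul_le_mul_of_nonneg_left _ (by positivity)
            exact div_le_div₀ hL0 hL hden0 hden
        _ = 4 * t * L / (a ^ 2 * (n : ℝ) ^ 3) * n := by field_simp; ring
    exact ⟨key (by linarith) (by linarith), key (by linarith) (by linarith)⟩
  -- the marks at time `t`, rescaled: `Xᵢ/n = x̂ᵢ + r/x̂ᵢ - s + εᵢ`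
  have hr0 : 0 ≤ r := by rw [hr]; positivity
  have hP : ∀ i, markFlow W (x i) t ω / n = ![a, b, c] i + r / ![a, b, c] i - s + ε i := by
    intro i
    have hxi0 : ![a, b, c] i ≠ 0 := by
      have : 0 < ![a, b, c] i := by fin_cases i <;> simp <;> linarith
      exact this.ne'
    rw [hrep i, hxv i, hr]
    simp only [hεdef, hsdef, hIdef, hxv i]
    field_simp
    ring
  -- smallness: `r/a + |s| + |εᵢ| ≤ ρ₀`
  have hsmall : ∀ i, r / a + |s| + |ε i| ≤ min (min a (b - a)) (c - b) / 4 := by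
    intro i
    have h1 : r / a = 2 * t / ((n : ℝ) ^ 2 * a) := by rw [hr]; field_simp
    have h2 : |s| ≤ q / (2 * n) :=
      calc |s| ≤ K / n := hs_le
        _ ≤ (q / 2) / n := by gcongr
        _ = q / (2 * n) := by ring
    have h3 := (hε_bound i).2
    linarith
  -- STEP 3: the deterministic expansion
  have hexp := abs_cardyEta_perturbed_sub_le ha hab hbc hr0 le_rfl (hsmall 0) (hsmall 1) (hsmall 2)
  have hη : etaProc W x t ω =
      cardyEta (a + r / a - s + ε 0) (b + r / b - s + ε 1) (c + r / c - s + ε 2) := by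
    have e0 := hP 0
    have e1 := hP 1
    have e2 := hP 2
    simp only [Matrix.cons_val_zero, Matrix.cons_val_one, Matrix.cons_val] at e0 e1 e2
    rw [← e0, ← e1, ← e2, ← cardyEta_mul hnpos.ne' (markFlow W (x 0) t ω / n)]
    simp only [etaProc, mul_div_cancel₀ _ hnpos.ne']
  rw [hη]
  refine hexp.trans ?_
  -- STEP 4: weaken the right-hand side to the `K`-form
  obtain ⟨ha', hab', hbc', hbb', -, -⟩ := drifted_base_bounds ha hab hbc hr0
    (by have := hsmall 0; have h0 : 0 ≤ |s| + |ε 0| := by positivity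
        have hρa : min (min a (b - a)) (c - b) / 4 ≤ a / 4 := by
          have := min_le_left (min a (b - a)) (c - b); have := min_le_left a (b - a); linarith
        linarith)
  have hS' : 0 ≤ (b + r / b - (a + r / a)) * (c + r / c - (b + r / b)) /
      ((b + r / b) ^ 2 * (c + r / c - (a + r / a))) :=
    div_nonneg (mul_nonneg (by linarith) (by linarith)) (mul_nonneg (sq_nonneg _) (by linarith))
  have hcoef : 0 ≤ 2 * ((b + r / b - (a + r / a)) * (c + r / c - (b + r / b)) /
      ((b + r / b) ^ 2 * (c + r / c - (a + r / a)))) / (b + r / b) ^ 2 := by positivity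
  have hLnn : 0 ≤ 10 * c * (c - b) / (b * (c - a) ^ 2) + 6 * a * c / (b ^ 2 * (c - a)) +
      10 * a * (b - a) / (b * (c - a) ^ 2) := by
    have hca : 0 < c - a := by linarith
    have hden1 : 0 < b * (c - a) ^ 2 := mul_pos hb (pow_pos hca 2)
    have hden2 : 0 < b ^ 2 * (c - a) := mul_pos (pow_pos hb 2) hca
    have h1 : 0 ≤ 10 * c * (c - b) / (b * (c - a) ^ 2) :=
      div_nonneg (mul_nonneg (by positivity) (by linarith)) hden1.le
    have h2 : 0 ≤ 6 * a * c / (b ^ 2 * (c - a)) := div_nonneg (by positivity) hden2.le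
    have h3 : 0 ≤ 10 * a * (b - a) / (b * (c - a) ^ 2) :=
      div_nonneg (mul_nonneg (by positivity) (by linarith)) hden1.le
    linarith
  have hs3 : |s| ^ 3 ≤ (K / n) ^ 3 := pow_le_pow_left₀ (abs_nonneg _) hs_le 3
  have hεsum : |ε 0| + |ε 1| + |ε 2| ≤ 3 * (4 * t * (K + 1) / (a ^ 2 * (n : ℝ) ^ 3)) := by
    linarith [(hε_bound 0).1, (hε_bound 1).1, (hε_bound 2).1]
  gcongr

/-- **Registered form** (glue sub-goal `farField_abs_incr_le_sure` of stmt-CriticalPhenomena-0746): the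
sure bound on the stopped-modulus increment at scale `n`. [folklore] -/
theorem farField_abs_incr_le_sure : ∀ {a b c : ℝ} {Ω : Type*} {W : Ω → ℝ≥0 → ℝ} {ω : Ω}, 0 < a → a < b → b < c → ∀ (t : ℝ≥0) {n : ℕ}, 0 < n → ((n : ℝ)) ^ (3 / 4 : ℝ) < n * min a (min (b - a) (c - b)) → ((n : ℝ)) ^ (3 / 4 : ℝ) ≤ n * a / 2 → 4 * (t : ℝ) / (n * a) < min 1 (((n : ℝ)) ^ (3 / 4 : ℝ) / 2) → (((n : ℝ)) ^ (3 / 4 : ℝ) + 1) / n ≤ min (min a (b - a)) (c - b) / 4 → Continuous (W ω) → W ω 0 = 0 → |etaProc W (fun i ↦ (n : ℝ) * ![a, b, c] i) (min (t : WithTop ℝ≥0) (levelTime W (fun i ↦ (n : ℝ) * ![a, b, c] i) (n * a - (n : ℝ) ^ (3 / 4 : ℝ)) (n * a + (n : ℝ) ^ (3 / 4 : ℝ)) (n * min (b - a) (c - b) - (n : ℝ) ^ (3 / 4 : ℝ)) ω)).untopA ω - cardyEta a b c| ≤ (10 * c * (c - b) / (b * (c - a) ^ 2) + 6 * a * c /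 (b ^ 2 * (c - a)) + 10 * a * (b - a) / (b * (c - a) ^ 2)) * (3 * ((((n : ℝ)) ^ (3 / 4 : ℝ) + 1) / n)) :=
  fun ha hab hbc t _ hn hq hqa h4t hρ hWc hW0 ↦ abs_incr_le_sure ha hab hbc t hn hq hqa h4t hρ hWc hW0

end Scale

end FarField

end Summit.CriticalPhenomena.CardyFormulaZ2.Cruxes.CardyRigidity.CrossingMartingale

end
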